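/-
Copyright (c) 2026 the pub-hodgecm-mathlib formalisation cell (harness21).  Prover seat hodgecm-mathlib-K2E5-p12 (g2), HCML Track B «K2-LIT», h413 =
`stmt-HodgeConjecture-24833`, line `K2_E3_EllipticInputs`, unit U3b, sub-line (ii♭-H) «RANK-ONE CAYLEY ROAD», letter (Ψ-package₂¹) — brick (γ): the
TYPE-(2) RAY clause (RAY¹) of the rank-one Cayley scaling, from the two arithmetic leaves (T2-EX), (T2-CPT).  2026-09-04.
-/
import Summits.HodgeConjecture.HodgeConjecture.Theorems.K2E3CayleyScalingRankOneStable       -- ★ (α) (this seat): the `e`-bridge currency; brings ★ (SC₂) chain, ★ p855742∕p855813 (ball, iterates, (T)), ★ Cayley algebra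
import Summits.HodgeConjecture.HodgeConjecture.Theorems.K2E3SplitPlaceGRegularCriterion       -- ★ `isLocalGRegular_of_discr_ne_zero_of_eval_ne_zero` (G-regularity from ONE place: `disc ≠ 0`, `χ(u_w) ≠ 0`)
import Literature.NumberTheory.Automorphic.LocalUnitaryGroupCenter                           -- ★ `forall_mem_center_cmLocal_eq_scalar` (central ⇒ scalar at a non-split place)
import Literature.NumberTheory.Automorphic.QuadraticPlaceDescentPins                         -- ★ `exists_units_galAdicCompletionMap_eq_neg` (a skew unit `λ₀`)
import Mathlib.Algebra.Polynomial.SpecificDegree                                             -- `Monic.irreducible_iff_roots_eq_zero_of_degree_le_three`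
import HarnessLib

/-!
# h413 ∕ K2-LIT, line `K2_E3_EllipticInputs`, unit U3b, (ii♭-H): THE TYPE-(2) RAY OF THE RANK-ONE CAYLEY SCALING — (RAY¹) ⟸ {(T2-EX), (T2-CPT)}
# (brick (γ) of the payer of (Ψ-package₂¹) `sig_K2E3RankOneUnipotentScalingPackageOne`)

Cell `pub/hodgecm-mathlib`, crux H413 = `stmt-HodgeConjecture-24833`; dealer ruling K2E3-plan (g2) 2026-09-04T01:04:01Z «Ψ-RAY: (A) TYPE (2) STAYS; (RAY¹) is its own
file ⟸ {(T2-EX), (T2-CPT)}»; leaf (T2-EX) = K2E3-p06 (g3) (D10), leaf (T2-CPT) = an E4 hand.  THEOREMS ONLY (no `def`, no `instance`, no `notation`, no `sorry`);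
lane `--supports stmt-HodgeConjecture-24833 --as helper`.  The two leaves enter as HYPOTHESES `hEX`, `hCPT` in the consumer binder shapes posted 01:12Z (K2/STATUS.md):
  (T2-EX)  `∃ μ : L_w, σ_w μ = μ ∧ μ ≠ 0 ∧ ¬ IsSquare μ`  (a `σ_w`-fixed non-square of the local quadratic extension `L_w ⊃ L⁺_v`);
  (T2-CPT) `∀ γ : U(Φ₂)(L⁺_v), Irreducible χ_γ (over `∏_{w∣v} L_w`) → CompactSpace Z(γ)`.

THE RAY.  `λ₀ ∈ L_wˣ` skew (★ `exists_units_galAdicCompletionMap_eq_neg`), `μ` from (T2-EX), `Y = !![0, λ₀; μλ₀, 0] ∈ 𝔲(σ_w, J₀)` (`J₀ = antidiag(1,1) = J_w`):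
`tr Y = 0`, `det Y = −μλ₀²`, so `disc(s^n•Y) = μ·(2λ₀s^n)²` is a NON-SQUARE and `disc c(s^n•Y) = 4·disc(s^n•Y)∕det(1 − s^n•Y)²` (★ `trace_sq_sub_four_det_cayley`) too:
`χ_{a·c(s^n Y)}` is IRREDUCIBLE for every unit `a` (§1, Mathlib `Monic.irreducible_iff_roots_eq_zero_of_degree_le_three`).  The start `t := e⁻¹ c(s^m Y)` lies in
`U₀ = e⁻¹B` for `m ≫ 0` (`‖s‖ < 1`); `Ψ^[k] t = e⁻¹ c(s^{m+k} Y)` (★ `iterate_cayleyScaling`) `→ 1` (★ (T)); a CENTRAL `ζ` is a scalar `u·1` at a non-split place (★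
`forall_mem_center_cmLocal_eq_scalar`), so `χ_{Ψ^[k]t·ζ}` read at `w` is `χ_{u_w·c(s^{m+k}Y)}`: irreducible over `L_w`, hence over `∏_{w′∣v} L_{w′} ≃+* L_w` (Mathlib
`RingEquiv.piUnique`, `Polynomial.mapEquiv`, `MulEquiv.irreducible_iff`); (T2-CPT) gives the compact centralisers; `G`-REGULARITY against every `λ ∈ U(Φ₁)_v` is ★
`isLocalGRegular_of_discr_ne_zero_of_eval_ne_zero` at `w` (`disc ≠ 0`; an irreducible monic quadratic has no root `u_w`).

HONEST LABEL.  HC_CM is proved only modulo the 7 printed citations (2 remaining named inputs: hLiu418 = `stmt-HodgeConjecture-24832`, h413 =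
`stmt-HodgeConjecture-24833`) until rung 0 closes; (RAY¹) here is CONDITIONAL on (T2-EX), (T2-CPT) (named hypotheses, both dealt); count-neutral helper.

## References
* [Rogawski1990] J. D. Rogawski, *Automorphic Representations of Unitary Groups in Three Variables* (1990), §3.6 p. 28 (torus types of `U(2)`), §3.5 Prop. 3.5.2 (c),
  §8.1 Props. 8.1.1–8.1.2 pp. 112–114, §4.3 p. 42 (`G`-regular).
* [PlatonovRapinchuk1994] V. Platonov, A. Rapinchuk, *Algebraic Groups and Number Theory* (1994), §3.3, §6.4 (anisotropic tori over local fields).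
* [HarishChandra1999AdmissibleDistributions] Harish-Chandra, *Admissible Invariant Distributions on Reductive p-adic Groups*, ULS 16 (1999), §3.1 Lemma 3.2.
-/

set_option autoImplicit false
set_option linter.dupNamespace false  -- the mandated namespace repeats the single-problem summit's segment (`HodgeConjecture.HodgeConjecture`)

noncomputable section

open NumberField IsDedekindDomain Matrix Filter Topology Set Polynomial
open scoped Matrix MatrixGroups
open Literature.NumberTheory.Rogawski1990 Literature.NumberTheory.Automorphic Literature.NumberTheory.Automorphic.UnitaryGroup
open Literature.NumberTheory.Weil1982.UnitaryFinTopForm Literature.LinearAlgebra.Matrix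
open Summit.HodgeConjecture.HodgeConjecture.Cruxes.H413.K2E3CayleyScalingAlgebra
open Summit.HodgeConjecture.HodgeConjecture.Cruxes.H413.K2E3CayleyScalingRankOne Summit.HodgeConjecture.HodgeConjecture.Cruxes.H413.K2E3CayleyScalingRankOneMap
open Summit.HodgeConjecture.HodgeConjecture.Cruxes.H413.K2E3RankOneTransvectionNormalForm (antidiagonal_two_over)
open Summit.HodgeConjecture.HodgeConjecture.Cruxes.H413.K2E3CentralTransferVanishingSplit (isLocalGRegular_of_discr_ne_zero_of_eval_ne_zero)

namespace Summit.HodgeConjecture.HodgeConjecture.Cruxes.H413.K2E3CayleyScalingRankOneRay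

/-! ## §1 Field algebra: irreducible quadratics from a non-square discriminant -/

section Field

variable {F : Type*} [Field F]

/-- **A `2 × 2` matrix whose discriminant `tr² − 4 det` is NOT A SQUARE has IRREDUCIBLE characteristic polynomial**: a root `r` of `T² − tr·T + det` would give
`(2r − tr)² = tr² − 4 det` (Mathlib `Matrix.charpoly_fin_two`, `Monic.irreducible_iff_roots_eq_zero_of_degree_le_three`). [cite: Rogawski1990, §3.6 p. 28] -/
theorem irreducible_charpoly_of_not_isSquare (M : Matrix (Fin 2) (Fin 2) F) (h : ¬ IsSquare (M.trace ^ 2 - 4 * M.det)) : Irreducible M.charpoly := by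
  have hdeg : M.charpoly.natDegree = 2 := by rw [Matrix.charpoly_natDegree_eq_dim, Fintype.card_fin]
  rw [(Matrix.charpoly_monic M).irreducible_iff_roots_eq_zero_of_degree_le_three (by omega) (by omega), Multiset.eq_zero_iff_forall_notMem]
  intro r hr
  rw [mem_roots (Matrix.charpoly_monic M).ne_zero, Matrix.charpoly_fin_two, IsRoot.def] at hr
  simp only [eval_add, eval_sub, eval_pow, eval_X, eval_mul, eval_C] at hr
  exact h ⟨2 * r - M.trace, by linear_combination (-4 : F) * hr⟩

/-- Scaling by a unit preserves the non-square discriminant: `disc(a • M) = a²·disc M`. [cite: Rogawski1990, §3.6 p. 28] -/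
theorem not_isSquare_discr_smul {a : F} (ha : a ≠ 0) {M : Matrix (Fin 2) (Fin 2) F} (h : ¬ IsSquare (M.trace ^ 2 - 4 * M.det)) :
    ¬ IsSquare ((a • M).trace ^ 2 - 4 * (a • M).det) := by
  obtain ⟨ht, hd⟩ := trace_smul_det_smul_fin_two a M
  rw [ht, hd]
  rintro ⟨r, hr⟩
  refine h ⟨r * a⁻¹, ?_⟩
  have hr' : a ^ 2 * (M.trace ^ 2 - 4 * M.det) = r * r := by rw [← hr]; ring
  field_simp
  linear_combination hr'

/-- **THE TYPE-(2) GENERATOR**: for `μ` a non-square and `b, c ≠ 0`, the matrix `X = c • !![0, b; μb, 0]` has non-square discriminant `μ·(2cb)²`.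
[cite: Rogawski1990, §3.6 p. 28] -/
theorem not_isSquare_discr_gen {μ b c : F} (hμ : ¬ IsSquare μ) (hb : b ≠ 0) (hc : c ≠ 0) (h2 : (2 : F) ≠ 0) :
    ¬ IsSquare ((c • (!![0, b; μ * b, 0] : Matrix (Fin 2) (Fin 2) F)).trace ^ 2 - 4 * (c • (!![0, b; μ * b, 0] : Matrix (Fin 2) (Fin 2) F)).det) := by
  have hdisc : (c • (!![0, b; μ * b, 0] : Matrix (Fin 2) (Fin 2) F)).trace ^ 2 - 4 * (c • (!![0, b; μ * b, 0] : Matrix (Fin 2) (Fin 2) F)).det =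
      μ * (2 * c * b) ^ 2 := by
    obtain ⟨ht, hd⟩ := trace_smul_det_smul_fin_two c (!![0, b; μ * b, 0] : Matrix (Fin 2) (Fin 2) F)
    rw [ht, hd, Matrix.trace_fin_two, Matrix.det_fin_two]
    simp
    ring
  rw [hdisc]
  rintro ⟨r, hr⟩
  have h0 : 2 * c * b ≠ 0 := mul_ne_zero (mul_ne_zero h2 hc) hb
  exact hμ ⟨r * (2 * c * b)⁻¹, by field_simp; linear_combination hr⟩

/-- **The Cayley transform keeps the discriminant a non-square**: `disc c(X) = 4·disc X ∕ det(1 − X)²` (★ `trace_sq_sub_four_det_cayley`). [cite: PlatonovRapinchuk1994, §3.3] -/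
theorem not_isSquare_discr_cayley {X : Matrix (Fin 2) (Fin 2) F} (hm : (1 - X).det ≠ 0) (h : ¬ IsSquare (X.trace ^ 2 - 4 * X.det)) :
    ¬ IsSquare ((cayley X).trace ^ 2 - 4 * (cayley X).det) := by
  rw [trace_sq_sub_four_det_cayley hm]
  rintro ⟨r, hr⟩
  refine h ⟨r * (1 - X).det * 2⁻¹, ?_⟩
  by_cases h2 : (2 : F) = 0
  · -- in characteristic `2` the discriminant is a square: `tr² − 4det = tr² = tr·tr`
    exact absurd ⟨X.trace, by rw [show (4 : F) = 2 * 2 by norm_num, h2]; ring⟩ h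
  · have key : 4 * (X.trace ^ 2 - 4 * X.det) = r * r * (1 - X).det ^ 2 := by
      rw [← hr]; field_simp
    field_simp
    linear_combination key

/-- **The skew generator is `J₀`-skew-hermitian**: for `σb = −b`, `σμ = μ`, `σc = c`, `X = c • !![0, b; μb, 0]` satisfies `(X^σ)ᵀ J₀ + J₀ X = 0`, `J₀ = antidiag(1, 1)`.
[cite: Rogawski1990, §3.6 p. 28] [cite: PlatonovRapinchuk1994, §3.3] -/
theorem skew_gen (σ : F →+* F) {μ b c : F} (hb : σ b = -b) (hμ : σ μ = μ) (hc : σ c = c) :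
    ((c • (!![0, b; μ * b, 0] : Matrix (Fin 2) (Fin 2) F)).map σ)ᵀ * (StdForm.antidiagonal 2).over F +
      (StdForm.antidiagonal 2).over F * (c • (!![0, b; μ * b, 0] : Matrix (Fin 2) (Fin 2) F)) = 0 := by
  rw [antidiagonal_two_over]
  ext i j
  fin_cases i <;> fin_cases j <;> simp [Matrix.mul_apply, Fin.sum_univ_two, hb, hμ, hc]

end Field

/-- `M · (a·1) = a • M` (scalars are central). [folklore] -/
theorem mul_scalar_eq_smul {R : Type*} [CommRing R] {n : Type*} [Fintype n] [DecidableEq n] (M : Matrix n n R) (a : R) :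
    M * Matrix.scalar n a = a • M := by
  ext i j
  simp [Matrix.scalar_apply, Matrix.mul_diagonal, mul_comm]

/-- Entrywise: `(a • M).map f = f a • M.map f` for a ring homomorphism `f`. [folklore] -/
theorem map_smul_eq {R S : Type*} [CommRing R] [CommRing S] {n : Type*} (f : R →+* S) (a : R) (M : Matrix n n R) :
    (a • M).map f = f a • M.map f := by
  ext i j
  simp [Matrix.map_apply]

/-! ## §2 The generator in the model `U(σ, J)(K)` -/

section Model

variable {K : Type*} [NormedField K] [IsUltrametricDist K] (σ : K →+* K) (J : Matrix (Fin 2) (Fin 2) K) {ρ : ℝ} {s : K}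
  {B : Set ↥(unitaryGroupOfForm σ J)}
  (hB : ∀ u : ↥(unitaryGroupOfForm σ J), u ∈ B ↔
    IsUnit (((u : GL (Fin 2) K) : Matrix (Fin 2) (Fin 2) K) + 1).det ∧
    ‖((((u : GL (Fin 2) K) : Matrix (Fin 2) (Fin 2) K) - 1) * (((u : GL (Fin 2) K) : Matrix (Fin 2) (Fin 2) K) + 1)⁻¹).trace‖ ≤ ρ ∧
    ‖((((u : GL (Fin 2) K) : Matrix (Fin 2) (Fin 2) K) - 1) * (((u : GL (Fin 2) K) : Matrix (Fin 2) (Fin 2) K) + 1)⁻¹).det‖ ≤ ρ ^ 2)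

include hB in
set_option maxHeartbeats 1600000 in
/-- **THE TYPE-(2) START IN THE BALL.**  `J = J₀ = antidiag(1,1)`, `2 ≠ 0`, `0 < ρ < 1`, `0 < ‖s‖ < 1`, `σs = s`; `λ₀ ≠ 0` skew (`σλ₀ = −λ₀`) and `μ` a `σ`-fixed NON-SQUARE.  Then some
`u ∈ B` has `X_u = s^m • !![0, λ₀; μλ₀, 0]` and, for every `k` and every scalar `a ≠ 0`, the discriminant of `a • c(s^k • X_u)` is a NON-SQUARE (`u = c(s^m•Y)`, ★ `cayleyGL`,
unitary by ★ `transpose_map_cayley_mul_mul_cayley`; §1). [cite: Rogawski1990, §3.6 p. 28] [cite: PlatonovRapinchuk1994, §3.3] -/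
theorem exists_mem_ball_not_isSquare_discr (hJ : J = (StdForm.antidiagonal 2).over K) (h2 : (2 : K) ≠ 0) (hρ0 : 0 < ρ) (hρ1 : ρ < 1) (hs0 : s ≠ 0) (hs1 : ‖s‖ < 1)
    (hσs : σ s = s) {lam0 μ : K} (hlam0 : lam0 ≠ 0) (hσlam0 : σ lam0 = -lam0) (hσμ : σ μ = μ) (hμ : ¬ IsSquare μ) :
    ∃ u : ↥(unitaryGroupOfForm σ J), u ∈ B ∧ ∀ (k : ℕ) (a : K), a ≠ 0 →
      ¬ IsSquare ((a • cayley (s ^ k • ((((u : GL (Fin 2) K) : Matrix (Fin 2) (Fin 2) K) - 1) * (((u : GL (Fin 2) K) : Matrix (Fin 2) (Fin 2) K) + 1)⁻¹))).trace ^ 2 -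
        4 * (a • cayley (s ^ k • ((((u : GL (Fin 2) K) : Matrix (Fin 2) (Fin 2) K) - 1) * (((u : GL (Fin 2) K) : Matrix (Fin 2) (Fin 2) K) + 1)⁻¹))).det) := by
  have h2u : IsUnit (2 : K) := isUnit_iff_ne_zero.2 h2
  set Y : Matrix (Fin 2) (Fin 2) K := !![0, lam0; μ * lam0, 0] with hYdef
  have hYtr : ∀ c : K, (c • Y).trace = 0 := fun c => by
    rw [(trace_smul_det_smul_fin_two c Y).1, hYdef, Matrix.trace_fin_two_of, add_zero, mul_zero]
  have hYdet : ∀ c : K, (c • Y).det = -(c ^ 2 * (μ * (lam0 * lam0))) := fun c => by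
    rw [(trace_smul_det_smul_fin_two c Y).2, hYdef, Matrix.det_fin_two_of]; ring
  -- the radius bookkeeping: `‖det (s^m • Y)‖ ≤ ρ²` for `m ≫ 0`
  set C : ℝ := ‖μ * (lam0 * lam0)‖ with hCdef
  have hC0 : 0 ≤ C := norm_nonneg _
  obtain ⟨m, hm⟩ := exists_pow_lt_of_lt_one (div_pos (pow_pos hρ0 2) (by linarith : (0 : ℝ) < C + 1)) hs1
  set X₀ : Matrix (Fin 2) (Fin 2) K := s ^ m • Y with hX₀def
  have hX₀tr : ‖X₀.trace‖ ≤ ρ := by rw [hX₀def, hYtr, norm_zero]; exact hρ0.le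
  have hX₀det : ‖X₀.det‖ ≤ ρ ^ 2 := by
    rw [hX₀def, hYdet, norm_neg, norm_mul, norm_pow, ← hCdef]
    have hsm1 : ‖s ^ m‖ ≤ 1 := by rw [norm_pow]; exact pow_le_one₀ (norm_nonneg _) hs1.le
    have hsm0 : 0 ≤ ‖s ^ m‖ := norm_nonneg _
    calc ‖s ^ m‖ ^ 2 * C ≤ ‖s ^ m‖ * C := by
          rw [sq]; exact mul_le_mul_of_nonneg_right (mul_le_of_le_one_left hsm0 hsm1) hC0
      _ ≤ ρ ^ 2 / (C + 1) * C := by rw [norm_pow]; exact mul_le_mul_of_nonneg_right hm.le hC0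
      _ ≤ ρ ^ 2 := by
          rw [div_mul_eq_mul_div]
          exact (div_le_iff₀ (by linarith)).2 (by nlinarith [pow_pos hρ0 2])
  obtain ⟨hm₀, hp₀⟩ := isUnit_det_one_sub_add_of_ball hρ1 hX₀tr hX₀det
  -- skewness and the unitary `u = c(X₀)`
  have hσsm : σ (s ^ m) = s ^ m := by rw [map_pow, hσs]
  have hskew : (X₀.map σ)ᵀ * J + J * X₀ = 0 := by
    rw [hJ, hX₀def, hYdef]
    exact skew_gen σ hσlam0 hσμ hσsm
  have huU : cayleyGL X₀ hm₀ hp₀ ∈ unitaryGroupOfForm σ J := mem_unitaryGroupOfForm_iff.2 (transpose_map_cayley_mul_mul_cayley σ hm₀ hskew)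
  refine ⟨⟨cayleyGL X₀ hm₀ hp₀, huU⟩, ?_, fun k a ha => ?_⟩
  · have hXu : ((((⟨cayleyGL X₀ hm₀ hp₀, huU⟩ : ↥(unitaryGroupOfForm σ J)) : GL (Fin 2) K) : Matrix (Fin 2) (Fin 2) K) - 1) *
        ((((⟨cayleyGL X₀ hm₀ hp₀, huU⟩ : ↥(unitaryGroupOfForm σ J)) : GL (Fin 2) K) : Matrix (Fin 2) (Fin 2) K) + 1)⁻¹ = X₀ := inverseWindow_cayley h2u hm₀
    refine (hB _).2 ⟨isUnit_det_cayley_add_one h2u hm₀, ?_, ?_⟩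
    · rw [hXu]; exact hX₀tr
    · rw [hXu]; exact hX₀det
  · have hXu : ((((⟨cayleyGL X₀ hm₀ hp₀, huU⟩ : ↥(unitaryGroupOfForm σ J)) : GL (Fin 2) K) : Matrix (Fin 2) (Fin 2) K) - 1) *
        ((((⟨cayleyGL X₀ hm₀ hp₀, huU⟩ : ↥(unitaryGroupOfForm σ J)) : GL (Fin 2) K) : Matrix (Fin 2) (Fin 2) K) + 1)⁻¹ = X₀ := inverseWindow_cayley h2u hm₀
    rw [hXu]
    have hmk : (1 - s ^ k • X₀).det ≠ 0 := by
      have hsk : ‖s ^ k‖ ≤ 1 := by rw [norm_pow]; exact pow_le_one₀ (norm_nonneg _) hs1.le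
      obtain ⟨ht, hd⟩ := ball_smul_of_norm_le_one hsk hX₀tr hX₀det
      exact (isUnit_det_one_sub_add_of_ball hρ1 ht hd).1.ne_zero
    refine not_isSquare_discr_smul ha (not_isSquare_discr_cayley hmk ?_)
    rw [hX₀def, smul_smul, hYdef]
    exact not_isSquare_discr_gen hμ hlam0 (mul_ne_zero (pow_ne_zero k hs0) (pow_ne_zero m hs0)) h2

end Model

/-! ## §3 On `G = U(Φ₂)(L⁺_v)`: reading at `w`, central scalars, irreducibility, `G`-regularity -/

section CM

variable (L : Type) [Field L] [NumberField L] [IsCMField L] {v : HeightOneSpectrum (𝓞 ↥(maximalRealSubfield L))}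
  (w : PlacesOver L v) (hw : IsCMField.complexConj L • w.1 = w.1)

include hw in
set_option maxHeartbeats 1600000 in
/-- **IRREDUCIBILITY OVER `∏_{w′∣v} L_{w′}` FROM THE READING AT `w`** (non-split `v`, so `eval_w : ∏_{w′∣v} L_{w′} ≃+* L_w`, Mathlib `RingEquiv.piUnique`): if `γ ∈ U(Φ₂)(L⁺_v)` reads
`N` at `w` and `disc(a_w • N)` is a non-square, then `χ_{a•γ}` is irreducible over the product ring (§1 + Mathlib `Polynomial.mapEquiv`, `MulEquiv.irreducible_iff`,
`Matrix.charpoly_map`). [cite: Rogawski1990, §3.6 p. 28] -/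
theorem irreducible_charpoly_smul_of_read (γ : (UnitaryGroup.cmDatum L 2 (Matrix.of fun i j : Fin 2 => if i.val + j.val + 1 = 2 then (1 : L) else 0)).Local v) (a : UnitaryGroup.LocalRing L v) {N : Matrix (Fin 2) (Fin 2) (w.1.adicCompletion L)}
    (hread : ((((γ : (UnitaryGroup.cmDatum L 2 (Matrix.of fun i j : Fin 2 => if i.val + j.val + 1 = 2 then (1 : L) else 0)).Local v).val : GL (Fin 2) (UnitaryGroup.LocalRing L v)).val)).map (Pi.evalRingHom (fun w' : PlacesOver L v => w'.1.adicCompletion L) w) = N) (hnsq : ¬ IsSquare (((a w) • N).trace ^ 2 - 4 * ((a w) • N).det)) :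
    Irreducible ((a • (((γ : (UnitaryGroup.cmDatum L 2 (Matrix.of fun i j : Fin 2 => if i.val + j.val + 1 = 2 then (1 : L) else 0)).Local v).val : GL (Fin 2) (UnitaryGroup.LocalRing L v)).val)).charpoly) := by
  haveI hquad : Algebra.IsQuadraticExtension ↥(maximalRealSubfield L) L := IsCMField.isQuadraticExtension L
  letI : Unique (PlacesOver L v) :=
    @uniqueOfSubsingleton _ (PlacesOver.subsingleton_of_smul_eq (IsCMField.complexConj L) (IsCMField.complexConj_ne_one L) w hw) w
  set Eᵣ : UnitaryGroup.LocalRing L v ≃+* w.1.adicCompletion L := RingEquiv.piUnique (fun w' : PlacesOver L v => w'.1.adicCompletion L) with hEᵣ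
  have hEhom : (Eᵣ : UnitaryGroup.LocalRing L v →+* w.1.adicCompletion L) = (Pi.evalRingHom (fun w' : PlacesOver L v => w'.1.adicCompletion L) w) := RingHom.ext fun _ => rfl
  refine (MulEquiv.irreducible_iff (Polynomial.mapEquiv Eᵣ)).1 ?_
  rw [Polynomial.mapEquiv_apply, ← Matrix.charpoly_map, map_smul_eq, hEhom, hread]
  exact irreducible_charpoly_of_not_isSquare _ hnsq

include hw in
set_option maxHeartbeats 1600000 in
/-- **A CENTRAL TRANSLATE: IRREDUCIBILITY AND `G`-REGULARITY FROM THE READING AT `w`.**  `ζ` central in `U(Φ₂)(L⁺_v)` is a scalar `u₀·1` (★ `forall_mem_center_cmLocal_eq_scalar`);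
if `γ` reads `N` at `w` and `disc(a • N)` is a non-square for EVERY `a ≠ 0`, then `χ_{γζ}` is irreducible and `(γζ, λ)` is `G`-regular for every `λ ∈ U(Φ₁)(L⁺_v)` (★
`isLocalGRegular_of_discr_ne_zero_of_eval_ne_zero` at `w`: `disc ≠ 0`, and an irreducible monic quadratic has no root `u_w`). [cite: Rogawski1990, §3.6 p. 28; §4.3 p. 42] -/
theorem irreducible_and_isLocalGRegular_mul_of_read (γ ζ : (UnitaryGroup.cmDatum L 2 (Matrix.of fun i j : Fin 2 => if i.val + j.val + 1 = 2 then (1 : L) else 0)).Local v) (hζ : ζ ∈ Subgroup.center ((UnitaryGroup.cmDatum L 2 (Matrix.of fun i j : Fin 2 => if i.val + j.val + 1 = 2 then (1 : L) else 0)).Local v)) (lam : (UnitaryGroup.cmDatum L 1 (Matrix.of fun i j : Fin 1 => if i.val + j.val + 1 = 1 then (1 : L) else 0)).Local v)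
    {N : Matrix (Fin 2) (Fin 2) (w.1.adicCompletion L)} (hread : ((((γ : (UnitaryGroup.cmDatum L 2 (Matrix.of fun i j : Fin 2 => if i.val + j.val + 1 = 2 then (1 : L) else 0)).Local v).val : GL (Fin 2) (UnitaryGroup.LocalRing L v)).val)).map (Pi.evalRingHom (fun w' : PlacesOver L v => w'.1.adicCompletion L) w) = N)
    (hnsq : ∀ a : w.1.adicCompletion L, a ≠ 0 → ¬ IsSquare ((a • N).trace ^ 2 - 4 * (a • N).det)) :
    Irreducible ((((γ * ζ : (UnitaryGroup.cmDatum L 2 (Matrix.of fun i j : Fin 2 => if i.val + j.val + 1 = 2 then (1 : L) else 0)).Local v).val : GL (Fin 2) (UnitaryGroup.LocalRing L v)).val).charpoly) ∧ IsLocalGRegular L v (γ * ζ, lam) := by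
  haveI hquad : Algebra.IsQuadraticExtension ↥(maximalRealSubfield L) L := IsCMField.isQuadraticExtension L
  have hc : IsCMField.complexConj L ≠ 1 := IsCMField.complexConj_ne_one L
  haveI hsub : Subsingleton (PlacesOver L v) := PlacesOver.subsingleton_of_smul_eq (IsCMField.complexConj L) hc w hw
  have hns : ∀ w' : PlacesOver L v, IsCMField.complexConj L • w'.1 = w'.1 := fun w' => by rw [Subsingleton.elim w' w]; exact hw
  obtain ⟨u₀, hu₀⟩ := forall_mem_center_cmLocal_eq_scalar L (Matrix.of fun i j : Fin 2 => if i.val + j.val + 1 = 2 then (1 : L) else 0) (antidiagOne_isHermitian L 2) (isUnit_antidiagOne_det L 2) v hns ζ hζ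
  have hζ' : ((ζ : (UnitaryGroup.cmDatum L 2 (Matrix.of fun i j : Fin 2 => if i.val + j.val + 1 = 2 then (1 : L) else 0)).Local v).val : GL (Fin 2) (UnitaryGroup.LocalRing L v)) = Matrix.GeneralLinearGroup.scalar (Fin 2) u₀ := hu₀
  have hprod : (((γ * ζ : (UnitaryGroup.cmDatum L 2 (Matrix.of fun i j : Fin 2 => if i.val + j.val + 1 = 2 then (1 : L) else 0)).Local v).val : GL (Fin 2) (UnitaryGroup.LocalRing L v)).val) = (u₀ : UnitaryGroup.LocalRing L v) • (((γ : (UnitaryGroup.cmDatum L 2 (Matrix.of fun i j : Fin 2 => if i.val + j.val + 1 = 2 then (1 : L) else 0)).Local v).val : GL (Fin 2) (UnitaryGroup.LocalRing L v)).val) := by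
    rw [show ((γ * ζ : (UnitaryGroup.cmDatum L 2 (Matrix.of fun i j : Fin 2 => if i.val + j.val + 1 = 2 then (1 : L) else 0)).Local v).val : GL (Fin 2) (UnitaryGroup.LocalRing L v)) = ((γ : (UnitaryGroup.cmDatum L 2 (Matrix.of fun i j : Fin 2 => if i.val + j.val + 1 = 2 then (1 : L) else 0)).Local v).val : GL (Fin 2) (UnitaryGroup.LocalRing L v)) * ((ζ : (UnitaryGroup.cmDatum L 2 (Matrix.of fun i j : Fin 2 => if i.val + j.val + 1 = 2 then (1 : L) else 0)).Local v).val : GL (Fin 2) (UnitaryGroup.LocalRing L v)) from Subgroup.coe_mul _ _ _, Units.val_mul, hζ',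
      Matrix.GeneralLinearGroup.coe_scalar, mul_scalar_eq_smul]
  have hu₀w : (u₀ : UnitaryGroup.LocalRing L v) w ≠ 0 := ((Pi.isUnit_iff.1 u₀.isUnit) w).ne_zero
  refine ⟨by rw [hprod]; exact irreducible_charpoly_smul_of_read L w hw γ _ hread (hnsq _ hu₀w), ?_⟩
  have hreadζ : ((((γ * ζ : (UnitaryGroup.cmDatum L 2 (Matrix.of fun i j : Fin 2 => if i.val + j.val + 1 = 2 then (1 : L) else 0)).Local v).val : GL (Fin 2) (UnitaryGroup.LocalRing L v)).val)).map (fun x : UnitaryGroup.LocalRing L v => x w) = ((u₀ : UnitaryGroup.LocalRing L v) w) • N := by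
    rw [hprod, show (fun x : UnitaryGroup.LocalRing L v => x w) = ⇑(Pi.evalRingHom (fun w' : PlacesOver L v => w'.1.adicCompletion L) w) from rfl, map_smul_eq, hread]; rfl
  refine isLocalGRegular_of_discr_ne_zero_of_eval_ne_zero L v (γ * ζ, lam) w ?_ ?_
  · rw [hreadζ]
    intro h0
    exact hnsq _ hu₀w (by rw [h0]; exact ⟨0, (mul_zero 0).symm⟩)
  · rw [hreadζ]
    have hI := irreducible_charpoly_of_not_isSquare _ (hnsq _ hu₀w)
    have hroots := ((Matrix.charpoly_monic _).irreducible_iff_roots_eq_zero_of_degree_le_three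
      (by rw [Matrix.charpoly_natDegree_eq_dim, Fintype.card_fin]) (by rw [Matrix.charpoly_natDegree_eq_dim, Fintype.card_fin]; omega)).1 hI
    intro h0
    have hmem : finGammaTwo L v (γ * ζ, lam) w ∈ ((((u₀ : UnitaryGroup.LocalRing L v) w) • N).charpoly).roots :=
      (mem_roots (Matrix.charpoly_monic _).ne_zero).2 h0
    rw [hroots] at hmem
    exact Multiset.notMem_zero _ hmem

end CM

/-! ## §4 The ray clause (RAY¹) for the Cayley pair -/

section Ray

variable (L : Type) [Field L] [NumberField L] [IsCMField L] {v : HeightOneSpectrum (𝓞 ↥(maximalRealSubfield L))}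
  (w : PlacesOver L v) (hw : IsCMField.complexConj L • w.1 = w.1) {ρ : ℝ} {s : w.1.adicCompletion L}
  {B : Set ↥(unitaryGroupOfForm (galAdicCompletionMap (L := L) (IsCMField.complexConj L) hw) (placeForm (Matrix.of fun i j : Fin 2 => if i.val + j.val + 1 = 2 then (1 : L) else 0) w.1))}
  (hB : ∀ u : ↥(unitaryGroupOfForm (galAdicCompletionMap (L := L) (IsCMField.complexConj L) hw) (placeForm (Matrix.of fun i j : Fin 2 => if i.val + j.val + 1 = 2 then (1 : L) else 0) w.1)), u ∈ B ↔
    IsUnit ((((u : ↥(unitaryGroupOfForm (galAdicCompletionMap (L := L) (IsCMField.complexConj L) hw) (placeForm (Matrix.of fun i j : Fin 2 => if i.val + j.val + 1 = 2 then (1 : L) else 0) w.1))) : GL (Fin 2) (w.1.adicCompletion L)) : Matrix (Fin 2) (Fin 2) (w.1.adicCompletion L)) + 1).det ∧ ‖(((((u : ↥(unitaryGroupOfForm (galAdicCompletionMap (L := L) (IsCMField.complexConj L) hw) (placeForm (Matrix.of fun i j : Fin 2 => if i.val + j.val + 1 = 2 then (1 : L) else 0) w.1))) : GL (Fin 2)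 (w.1.adicCompletion L)) : Matrix (Fin 2) (Fin 2) (w.1.adicCompletion L)) - 1) * ((((u : ↥(unitaryGroupOfForm (galAdicCompletionMap (L := L) (IsCMField.complexConj L) hw) (placeForm (Matrix.of fun i j : Fin 2 => if i.val + j.val + 1 = 2 then (1 : L) else 0) w.1))) : GL (Fin 2) (w.1.adicCompletion L)) : Matrix (Fin 2) (Fin 2) (w.1.adicCompletion L)) + 1)⁻¹).trace‖ ≤ ρ ∧ ‖(((((u : ↥(unitaryGroupOfForm (galAdicCompletionMap (L := L) (IsCMField.complexConj L) hw) (placeForm (Matrix.of fun i j : Fin 2 => if i.val + j.val + 1 = 2 then (1 : L) else 0) w.1))) : GL (Fin 2) (w.1.adicCompletion L)) : Matrix (Fin 2) (Fin 2) (w.1.adicCompletion L)) - 1) * ((((u : ↥(unitaryGroupOfForm (galAdicCompletionMap (L := L) (IsCMField.complexConj L) hw) (placeForm (Matrix.of fun i j : Fin 2 => if i.val + j.val + 1 = 2 then (1 : L) else 0) w.1))) : GL (Fin 2) (w.1.adicCompletion L)) : Matrix (Fin 2) (Fin 2) (w.1.adicCompletion L)) + 1)⁻¹).det‖ ≤ ρ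 ^ 2)
  {Ψ : ↥(unitaryGroupOfForm (galAdicCompletionMap (L := L) (IsCMField.complexConj L) hw) (placeForm (Matrix.of fun i j : Fin 2 => if i.val + j.val + 1 = 2 then (1 : L) else 0) w.1)) → ↥(unitaryGroupOfForm (galAdicCompletionMap (L := L) (IsCMField.complexConj L) hw) (placeForm (Matrix.of fun i j : Fin 2 => if i.val + j.val + 1 = 2 then (1 : L) else 0) w.1))}
  (hΨ : ∀ u ∈ B, (((Ψ u : ↥(unitaryGroupOfForm (galAdicCompletionMap (L := L) (IsCMField.complexConj L) hw) (placeForm (Matrix.of fun i j : Fin 2 => if i.val + j.val + 1 = 2 then (1 : L) else 0) w.1))) : GL (Fin 2) (w.1.adicCompletion L)) : Matrix (Fin 2) (Fin 2) (w.1.adicCompletion L)) = cayley (s • (((((u : ↥(unitaryGroupOfForm (galAdicCompletionMap (L := L) (IsCMField.complexConj L) hw) (placeForm (Matrix.of fun i j : Fin 2 => if i.val + j.val + 1 = 2 then (1 : L) else 0) w.1))) : GL (Fin 2) (w.1.adicCompletion L)) : Matrix (Fin 2) (Fin 2) (w.1.adicCompletion L)) - 1) * ((((u : ↥(unitaryGroupOfForm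 (galAdicCompletionMap (L := L) (IsCMField.complexConj L) hw) (placeForm (Matrix.of fun i j : Fin 2 => if i.val + j.val + 1 = 2 then (1 : L) else 0) w.1))) : GL (Fin 2) (w.1.adicCompletion L)) : Matrix (Fin 2) (Fin 2) (w.1.adicCompletion L)) + 1)⁻¹)) ∧
    (((((Ψ u : ↥(unitaryGroupOfForm (galAdicCompletionMap (L := L) (IsCMField.complexConj L) hw) (placeForm (Matrix.of fun i j : Fin 2 => if i.val + j.val + 1 = 2 then (1 : L) else 0) w.1))) : GL (Fin 2) (w.1.adicCompletion L)))⁻¹ : GL (Fin 2) (w.1.adicCompletion L)) : Matrix (Fin 2) (Fin 2) (w.1.adicCompletion L)) = cayley (-(s • (((((u : ↥(unitaryGroupOfForm (galAdicCompletionMap (L := L) (IsCMField.complexConj L) hw) (placeForm (Matrix.of fun i j : Fin 2 => if i.val + j.val + 1 = 2 then (1 : L) else 0) w.1))) : GL (Fin 2) (w.1.adicCompletion L)) : Matrix (Fin 2) (Fin 2) (w.1.adicCompletion L)) - 1) * ((((u : ↥(unitaryGroupOfForm (galAdicCompletionMap (L := L) (IsCMField.complexConj L) hw) (placeForm (Matrix.of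 fun i j : Fin 2 => if i.val + j.val + 1 = 2 then (1 : L) else 0) w.1))) : GL (Fin 2) (w.1.adicCompletion L)) : Matrix (Fin 2) (Fin 2) (w.1.adicCompletion L)) + 1)⁻¹))))

include hB hΨ in
set_option maxHeartbeats 1600000 in
/-- **(RAY¹) FOR THE CAYLEY PAIR, FROM (T2-EX) AND (T2-CPT).**  `σ_w s = s`, `0 < ‖s‖ < 1`, `0 < ρ < 1`; `hEX` = (T2-EX) at `w`, `hCPT` = (T2-CPT).  For every CENTRAL
`ζ ∈ U(Φ₂)(L⁺_v)` and every `λ ∈ U(Φ₁)(L⁺_v)` there is a start `t ∈ U₀ = e⁻¹(B)` whose Cayley orbit `Ψ_G^[k] t` (`Ψ_G = e⁻¹ ∘ Ψ ∘ e`) consists of elements with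
IRREDUCIBLE `χ_{Ψ^[k]t · ζ}`, COMPACT centralisers, `G`-REGULAR partners `(Ψ^[k] t · ζ, λ)`, and `Ψ^[k] t → 1` (§2 start, ★ `iterate_cayleyScaling`, §3, ★ (T)).
[cite: Rogawski1990, §3.6 p. 28; §8.1 Props. 8.1.1–8.1.2 pp. 112–114; §4.3 p. 42] [cite: PlatonovRapinchuk1994, §3.3; §6.4] -/
theorem exists_ray_of_nonsquare_of_compact (hσs : (galAdicCompletionMap (L := L) (IsCMField.complexConj L) hw) s = s) (hs0 : s ≠ 0) (hs1 : ‖s‖ < 1) (hρ0 : 0 < ρ) (hρ1 : ρ < 1)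
    (hEX : ∃ μ : w.1.adicCompletion L, (galAdicCompletionMap (L := L) (IsCMField.complexConj L) hw) μ = μ ∧ μ ≠ 0 ∧ ¬ IsSquare μ)
    (hCPT : ∀ γ : (UnitaryGroup.cmDatum L 2 (Matrix.of fun i j : Fin 2 => if i.val + j.val + 1 = 2 then (1 : L) else 0)).Local v, Irreducible (((((γ : (UnitaryGroup.cmDatum L 2 (Matrix.of fun i j : Fin 2 => if i.val + j.val + 1 = 2 then (1 : L) else 0)).Local v).val : GL (Fin 2) (UnitaryGroup.LocalRing L v)).val)).charpoly) → CompactSpace ↥(Subgroup.centralizer ({γ} : Set ((UnitaryGroup.cmDatum L 2 (Matrix.of fun i j : Fin 2 => if i.val + j.val + 1 = 2 then (1 : L) else 0)).Local v))))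
    (ζ : (UnitaryGroup.cmDatum L 2 (Matrix.of fun i j : Fin 2 => if i.val + j.val + 1 = 2 then (1 : L) else 0)).Local v) (hζ : ζ ∈ Subgroup.center ((UnitaryGroup.cmDatum L 2 (Matrix.of fun i j : Fin 2 => if i.val + j.val + 1 = 2 then (1 : L) else 0)).Local v)) (lam : (UnitaryGroup.cmDatum L 1 (Matrix.of fun i j : Fin 1 => if i.val + j.val + 1 = 1 then (1 : L) else 0)).Local v) :
    ∃ t : (UnitaryGroup.cmDatum L 2 (Matrix.of fun i j : Fin 2 => if i.val + j.val + 1 = 2 then (1 : L) else 0)).Local v, (localNonsplitEquiv (IsCMField.complexConj L) (Matrix.of fun i j : Fin 2 => if i.val + j.val + 1 = 2 then (1 : L) else 0) (IsCMField.complexConj_ne_one L) w hw) t ∈ B ∧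
      (∀ k : ℕ, IsLocalGRegular L v ((fun γ : (UnitaryGroup.cmDatum L 2 (Matrix.of fun i j : Fin 2 => if i.val + j.val + 1 = 2 then (1 : L) else 0)).Local v => (localNonsplitEquiv (IsCMField.complexConj L) (Matrix.of fun i j : Fin 2 => if i.val + j.val + 1 = 2 then (1 : L) else 0) (IsCMField.complexConj_ne_one L) w hw).symm (Ψ ((localNonsplitEquiv (IsCMField.complexConj L) (Matrix.of fun i j : Fin 2 => if i.val + j.val + 1 = 2 then (1 : L) else 0) (IsCMField.complexConj_ne_one L) w hw) γ)))^[k] t * ζ, lam)) ∧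
      (∀ k : ℕ, CompactSpace ↥(Subgroup.centralizer ({(fun γ : (UnitaryGroup.cmDatum L 2 (Matrix.of fun i j : Fin 2 => if i.val + j.val + 1 = 2 then (1 : L) else 0)).Local v => (localNonsplitEquiv (IsCMField.complexConj L) (Matrix.of fun i j : Fin 2 => if i.val + j.val + 1 = 2 then (1 : L) else 0) (IsCMField.complexConj_ne_one L) w hw).symm (Ψ ((localNonsplitEquiv (IsCMField.complexConj L) (Matrix.of fun i j : Fin 2 => if i.val + j.val + 1 = 2 then (1 : L) else 0) (IsCMField.complexConj_ne_one L) w hw) γ)))^[k] t} : Set ((UnitaryGroup.cmDatum L 2 (Matrix.of fun i j : Fin 2 => if i.val + j.val + 1 = 2 then (1 : L) else 0)).Local v)))) ∧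
      (∀ k : ℕ, Irreducible ((((((fun γ : (UnitaryGroup.cmDatum L 2 (Matrix.of fun i j : Fin 2 => if i.val + j.val + 1 = 2 then (1 : L) else 0)).Local v => (localNonsplitEquiv (IsCMField.complexConj L) (Matrix.of fun i j : Fin 2 => if i.val + j.val + 1 = 2 then (1 : L) else 0) (IsCMField.complexConj_ne_one L) w hw).symm (Ψ ((localNonsplitEquiv (IsCMField.complexConj L) (Matrix.of fun i j : Fin 2 => if i.val + j.val + 1 = 2 then (1 : L) else 0) (IsCMField.complexConj_ne_one L) w hw) γ)))^[k] t * ζ : (UnitaryGroup.cmDatum L 2 (Matrix.of fun i j : Fin 2 => if i.val + j.val + 1 = 2 then (1 : L) else 0)).Local v).val : GL (Fin 2) (UnitaryGroup.LocalRing L v)).val)).charpoly)) ∧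
      Tendsto (fun k : ℕ => (fun γ : (UnitaryGroup.cmDatum L 2 (Matrix.of fun i j : Fin 2 => if i.val + j.val + 1 = 2 then (1 : L) else 0)).Local v => (localNonsplitEquiv (IsCMField.complexConj L) (Matrix.of fun i j : Fin 2 => if i.val + j.val + 1 = 2 then (1 : L) else 0) (IsCMField.complexConj_ne_one L) w hw).symm (Ψ ((localNonsplitEquiv (IsCMField.complexConj L) (Matrix.of fun i j : Fin 2 => if i.val + j.val + 1 = 2 then (1 : L) else 0) (IsCMField.complexConj_ne_one L) w hw) γ)))^[k] t) atTop (𝓝 1) := by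
  haveI hquad : Algebra.IsQuadraticExtension ↥(maximalRealSubfield L) L := IsCMField.isQuadraticExtension L
  have hc : IsCMField.complexConj L ≠ 1 := IsCMField.complexConj_ne_one L
  haveI : CharZero (w.1.adicCompletion L) := charZero_of_injective_algebraMap (algebraMap L (w.1.adicCompletion L)).injective
  have h2 : (2 : w.1.adicCompletion L) ≠ 0 := two_ne_zero
  have hJw : placeForm (Matrix.of fun i j : Fin 2 => if i.val + j.val + 1 = 2 then (1 : L) else 0) w.1 = (StdForm.antidiagonal 2).over (w.1.adicCompletion L) := by
    rw [placeForm, antidiagOne_eq_over, StdForm.over_map]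
  obtain ⟨lam0, hlam0⟩ := exists_units_galAdicCompletionMap_eq_neg (IsCMField.complexConj L) hc v w hw
  obtain ⟨μ, hσμ, -, hμsq⟩ := hEX
  obtain ⟨u, hu, hnsq⟩ := exists_mem_ball_not_isSquare_discr _ _ hB hJw h2 hρ0 hρ1 hs0 hs1 hσs lam0.ne_zero hlam0 hσμ hμsq
  -- the orbit `Ψ_G^[k] (e⁻¹ u) = e⁻¹ (Ψ^[k] u)`, read at `w` as `c(s^k • X_u)`
  have hiter : ∀ k : ℕ, (fun γ : (UnitaryGroup.cmDatum L 2 (Matrix.of fun i j : Fin 2 => if i.val + j.val + 1 = 2 then (1 : L) else 0)).Local v => (localNonsplitEquiv (IsCMField.complexConj L) (Matrix.of fun i j : Fin 2 => if i.val + j.val + 1 = 2 then (1 : L) else 0) (IsCMField.complexConj_ne_one L) w hw).symm (Ψ ((localNonsplitEquiv (IsCMField.complexConj L) (Matrix.of fun i j : Fin 2 => if i.val + j.val + 1 = 2 then (1 : L) else 0) (IsCMField.complexConj_ne_one L) w hw) γ)))^[k] ((localNonsplitEquiv (IsCMField.complexConj L) (Matrix.of fun i j : Fin 2 => if i.val +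 j.val + 1 = 2 then (1 : L) else 0) (IsCMField.complexConj_ne_one L) w hw).symm u) = (localNonsplitEquiv (IsCMField.complexConj L) (Matrix.of fun i j : Fin 2 => if i.val + j.val + 1 = 2 then (1 : L) else 0) (IsCMField.complexConj_ne_one L) w hw).symm (Ψ^[k] u) := by
    intro k
    induction k with
    | zero => simp
    | succ k ih => rw [Function.iterate_succ_apply', Function.iterate_succ_apply', ih, ContinuousMulEquiv.apply_symm_apply]
  have hread : ∀ k : ℕ, (((((fun γ : (UnitaryGroup.cmDatum L 2 (Matrix.of fun i j : Fin 2 => if i.val + j.val + 1 = 2 then (1 : L) else 0)).Local v => (localNonsplitEquiv (IsCMField.complexConj L) (Matrix.of fun i j : Fin 2 => if i.val + j.val + 1 = 2 then (1 : L) else 0) (IsCMField.complexConj_ne_one L) w hw).symm (Ψ ((localNonsplitEquiv (IsCMField.complexConj L) (Matrix.of fun i j : Fin 2 => if i.val + j.val + 1 = 2 then (1 : L) else 0) (IsCMField.complexConj_ne_one L) w hw) γ)))^[k] ((localNonsplitEquiv (IsCMField.complexConj L) (Matrix.of fun i j : Fin 2 => if i.val + j.val + 1 = 2 then (1 : L)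 else 0) (IsCMField.complexConj_ne_one L) w hw).symm u) : (UnitaryGroup.cmDatum L 2 (Matrix.of fun i j : Fin 2 => if i.val + j.val + 1 = 2 then (1 : L) else 0)).Local v).val : GL (Fin 2) (UnitaryGroup.LocalRing L v)).val)).map (Pi.evalRingHom (fun w' : PlacesOver L v => w'.1.adicCompletion L) w) = cayley (s ^ k • (((((u : ↥(unitaryGroupOfForm (galAdicCompletionMap (L := L) (IsCMField.complexConj L) hw) (placeForm (Matrix.of fun i j : Fin 2 => if i.val + j.val + 1 = 2 then (1 : L) else 0) w.1))) : GL (Fin 2) (w.1.adicCompletion L)) : Matrix (Fin 2) (Fin 2) (w.1.adicCompletion L)) - 1) * ((((u : ↥(unitaryGroupOfForm (galAdicCompletionMap (L := L) (IsCMField.complexConj L) hw) (placeForm (Matrix.of fun i j : Fin 2 => if i.val + j.val + 1 = 2 then (1 : L) else 0) w.1))) : GL (Fin 2) (w.1.adicCompletion L)) : Matrix (Fin 2) (Fin 2) (w.1.adicCompletion L)) + 1)⁻¹)) := fun k => by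
    rw [← (iterate_cayleyScaling _ _ hB hΨ h2 hs1.le hρ1 hu k).2.1, ← coe_localNonsplitEquiv_apply L (Matrix.of fun i j : Fin 2 => if i.val + j.val + 1 = 2 then (1 : L) else 0) v w hw, hiter k,
      ContinuousMulEquiv.apply_symm_apply]
  refine ⟨(localNonsplitEquiv (IsCMField.complexConj L) (Matrix.of fun i j : Fin 2 => if i.val + j.val + 1 = 2 then (1 : L) else 0) (IsCMField.complexConj_ne_one L) w hw).symm u, by rw [ContinuousMulEquiv.apply_symm_apply]; exact hu, fun k => ?_, fun k => ?_, fun k => ?_, ?_⟩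
  · exact (irreducible_and_isLocalGRegular_mul_of_read L w hw _ ζ hζ lam (hread k) (hnsq k)).2
  · refine hCPT _ ?_
    have h1 := irreducible_charpoly_smul_of_read L w hw ((fun γ : (UnitaryGroup.cmDatum L 2 (Matrix.of fun i j : Fin 2 => if i.val + j.val + 1 = 2 then (1 : L) else 0)).Local v => (localNonsplitEquiv (IsCMField.complexConj L) (Matrix.of fun i j : Fin 2 => if i.val + j.val + 1 = 2 then (1 : L) else 0) (IsCMField.complexConj_ne_one L) w hw).symm (Ψ ((localNonsplitEquiv (IsCMField.complexConj L) (Matrix.of fun i j : Fin 2 => if i.val + j.val + 1 = 2 then (1 : L) else 0) (IsCMField.complexConj_ne_one L) w hw) γ)))^[k] ((localNonsplitEquiv (IsCMField.complexConj L) (Matrix.of fun i j : Fin 2 => if i.val + j.val + 1 = 2 then (1 : L) else 0) (IsCMField.complexConj_ne_one L) w hw).symm u)) 1 (hread k)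
      (by rw [Pi.one_apply]; exact hnsq k 1 one_ne_zero)
    rwa [one_smul] at h1
  · exact (irreducible_and_isLocalGRegular_mul_of_read L w hw _ ζ hζ lam (hread k) (hnsq k)).1
  · have hsc : Continuous (fun x => (localNonsplitEquiv (IsCMField.complexConj L) (Matrix.of fun i j : Fin 2 => if i.val + j.val + 1 = 2 then (1 : L) else 0) (IsCMField.complexConj_ne_one L) w hw).symm x) := (localNonsplitEquiv (IsCMField.complexConj L) (Matrix.of fun i j : Fin 2 => if i.val + j.val + 1 = 2 then (1 : L) else 0) (IsCMField.complexConj_ne_one L) w hw).symm.continuous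
    have key := (hsc.tendsto 1).comp (iterate_mem_tendsto_cayleyScaling _ _ hB hΨ h2 hs1 hρ1 hu).2
    rw [map_one] at key
    simp_rw [hiter]
    exact key

end Ray

end Summit.HodgeConjecture.HodgeConjecture.Cruxes.H413.K2E3CayleyScalingRankOneRay

end
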